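import Summits.CriticalPhenomena.PercolationContinuityZ3.Theorems.Transplant.KNCells2WitnessLevel
import Summits.CriticalPhenomena.PercolationContinuityZ3.Theorems.Transplant.KNCellsZd
import Summits.CriticalPhenomena.PercolationContinuityZ3.Theorems.PercNearOneGluingNoHeavySamePZd
import Literature.Probability.Percolation.KozmaNitzanSteps
import HarnessLib

/-!
# ℤ^d REGRESSION of the lag-1 node theorem, part 1 — Kozma–Nitzan's own cells (`CellGeom.ofCells C`, anchors `Unit`) satisfy every
# GEOMETRIC hypothesis of `KNCells.KSchA.samePWitnessAt_of_kit₂'` (`RunGeom`, `AnchGeom`, `SepGeom₂`, `ExitGeom`, `StepsGeom`, `LevelGeom`, `hB`)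

builds on p205010 (kernel theorem, internal audit signed; external expert review pending) — nothing in this file uses p205010 (the module
`PercNearOneGluingNoHeavySamePZd` is imported only for p4's envelope cube bound `SameP.envRegion_subset_cube`).
Lane `prim-bschramm`, seat `prim-bschramm-stmt` (gen 3); helper file (`--supports stmt-CriticalPhenomena-4575`).

Purpose (regression / non-vacuity test of the generic F8 layer, cf. `KNLevelsZdRegression`, `KNLevelsZdBridge` for Lemmas 10–12): the single
target for the instances, p2-g2's `samePWitnessAt_of_kit₂'`, has six geometric structure hypotheses, a degree bound and a uniform envelope bound.
This file discharges all of them on the MODEL CASE `G = zdGraph d`, `Γ = CellGeom.ofCells C` (p2-g2's `KNCellsZd`: KN's cells with trivial anchors),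
each field from the corresponding lemma of the Literature formalisation of [KozmaNitzan2024, §4] (`L/KozmaNitzanScheme.lean`,
`L/KozmaNitzanSteps.lean`): `runGeom_ofCells`, `anchGeom_ofCells`, `sepGeom_ofCells`, `sepGeom₂_ofCells`, `exitGeom_ofCells`, the face data
`faceDataOfCells` with `stepsGeom_ofCells`, the level data `levelDataOfCells` (`σ (y_a - cen_v,a)`, `L j = 5r + 10sj`, `ℓQ = 5r`) with
`levelGeom_ofCells`, and the envelope bound `card_envRegion₂_ofKSch_le` (`#envRegion₂ ≤ (70r+1)^d` from p4's `SameP.envRegion_subset_cube`, the cube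
of radius `35r` around the source centre; `hΔ` is `degree_zdGraph_le_two_mul` verbatim).  Part 2
(`KNCells2ZdRegression`) transports the three probabilistic inputs from KN's `hQ0_of_hit` / `cond_of_face` / `reach_bound`.

[cite: KozmaNitzan2024, §4 pp. 25–31 (Q_v, M_v, E_{v,x}, H^j_{v,x}, F^j_{v,x}, (29), Step IV) — the ℤ^d model] [cite: GrimmettPercolation1999, §7.2]
-/

noncomputable section

open MeasureTheory ProbabilityTheory
open scoped ENNReal Classical

namespace Summit.CriticalPhenomena.PercolationContinuityZ3.Theorems

namespace Transplant

namespace KNCells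

open Literature.Probability.Percolation Literature.Probability.LatticeModels SimpleGraph GadgetSystem ProbeHistory HSiteScheme Contour
open Literature.Probability.Percolation.KozmaNitzan
open Literature.Probability.Percolation.KozmaNitzan.Cells (oth oth_ne sgOf sgOf_sign stepVec_apply_fst stepVec_apply_oth eq_oth_of_ne oth_oth
  eq_of_coords)

variable {d : ℕ} (C : Cells d)

namespace ZdReg

/-! ## §1 `RunGeom`, `AnchGeom` -/

/-- **`RunGeom`** for KN's cells: every point of `Q_v`, `Btw`, `H^j` has a lattice neighbour inside. [folklore] -/
theorem runGeom_ofCells : RunGeom (zdGraph d) (CellGeom.ofCells C) where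
  adjQ _ v y hy := by
    have hd : 0 < d := by have := C.hd; omega
    have hr : 1 ≤ 5 * C.r := by have := C.r_pos; omega
    exact exists_adj_of_mem_cIcc hd hr hy
  adjBtw _ v δ y hy := C.exists_adj_of_mem_sBox (by have := C.r_pos; omega) hy
  adjStub _ v δ j _ y hy := C.exists_adj_of_mem_sBox (by have := C.r_pos; omega) hy

/-- **`AnchGeom`** for KN's cells (trivial anchors). [folklore] -/
theorem anchGeom_ofCells : AnchGeom (CellGeom.ofCells C) where
  refl a _ := Finset.mem_singleton_self a
  const _ _ _ := rfl

/-! ## §2 `SepGeom`, `SepGeom₂` -/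

/-- `0 ∈ Q_0`. [folklore] -/
theorem zero_mem_Q_zero : (0 : Site d) ∈ C.Q 0 := by
  rw [Cells.Q, C.cen_zero]
  exact center_mem_cIcc 0 _

/-- **`SepGeom`** for KN's cells: the separation / containment / marker facts of `L/KozmaNitzanScheme.lean`, `L/KozmaNitzanSteps.lean`.
[cite: KozmaNitzan2024, §4 pp. 25–26] -/
theorem sepGeom_ofCells : SepGeom (zdGraph d) (CellGeom.ofCells C) where
  anch_refl a _ := Finset.mem_singleton_self a
  root_mem := zero_mem_Q_zero C
  Q_subset_Cell _ v := C.Q_subset_Cell v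
  Btw_subset_Cells _ _ v δ _ := fun _ hy => C.Ewv_subset_Cells v δ (Finset.mem_union_left _ hy)
  Stub_subset_Q_union_Btw _ _ v δ _ _ hj := C.Stub_subset_Q_union_Btw v δ hj
  Stub_subset_Cell_union_Zone _ _ v δ _ _ hj := C.Stub_subset_Cell_union_Zone v δ hj
  Efar_subset_Btw_union_Q _ v δ := C.Efar_subset_Btw_union_Q v δ
  Ewv_disjoint_Efar _ _ w δw du hdu := Finset.disjoint_left.2 fun y hy hy' => C.Ewv_disjoint_Efar hdu hy hy'
  Q_disjoint_Q _ _ _ _ hux := C.Q_disjoint_Q hux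
  Q_disjoint_Btw _ _ x v δ := C.Q_disjoint_Btw x v δ
  Btw_disjoint_Btw _ _ _ _ _ _ h1 h2 := C.Btw_disjoint_Btw h1 h2
  Q_disjoint_Efar _ _ v δ := Finset.disjoint_left.2 fun _ hy => C.Q_disjoint_Efar hy
  Btw_disjoint_Efar _ _ v δ δ' h := Finset.disjoint_left.2 fun y hy hy' => ((C.Btw_sep_Efar h) y hy y hy').1 rfl
  col_Q _ x := ⟨C.cen x, center_mem_cIcc _ _, Set.mem_singleton _⟩
  col_Cell _ u x hux y hy hcol := by
    have hy' : y = C.cen x := Set.mem_singleton_iff.1 hcol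
    subst hy'
    exact hux (C.eq_of_cen_mem_Cell hy).symm
  col_Zone _ u δ x y hy hcol := by
    have hy' : y = C.cen x := Set.mem_singleton_iff.1 hcol
    subst hy'
    exact C.cen_not_mem_Zone x u δ hy

/-- **`SepGeom₂`** for KN's cells (the cross-anchor containments are the plain ones). [cite: KozmaNitzan2024, §4 pp. 25–26] -/
theorem sepGeom₂_ofCells : SepGeom₂ (zdGraph d) (CellGeom.ofCells C) where
  toSepGeom := sepGeom_ofCells C
  Q_subset_Cell₂ _ _ x _ := C.Q_subset_Cell x
  Btw_subset_Cells₂ _ _ v δ _ := fun _ hy => C.Ewv_subset_Cells v δ (Finset.mem_union_left _ hy)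

/-! ## §3 `ExitGeom` -/

/-- The step vector has entries of absolute value `≤ 1`. [folklore] -/
theorem abs_stepVec_le (δ : MDir) (i : Fin 2) : |stepVec δ i| ≤ 1 := by
  rcases eq_or_ne i δ.1 with rfl | hi
  · rw [stepVec_apply_fst]; rcases sgOf_sign δ with h | h <;> rw [h] <;> simp
  · rw [eq_oth_of_ne hi, stepVec_apply_oth]; simp

/-- A point of `E_{w,δ}` has planar coordinates within `30 r` of `20 r (w + δ)`. [folklore] -/
theorem planar_of_mem_Ewv {w : Site 2} {δ : MDir} {b : Site d} (hb : b ∈ C.Ewv w δ) (i : Fin 2) :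
    |b (C.pax i) - 20 * C.r * (w + stepVec δ) i| ≤ 30 * C.r := by
  have hr : (0 : ℤ) ≤ C.r := by positivity
  have hst := abs_le.1 (abs_stepVec_le δ i)
  rw [Pi.add_apply, abs_le]
  rcases Finset.mem_union.1 (C.Ewv_subset_Cells w δ hb) with h | h
  · have h1 := C.planar_of_mem_Cell h i
    constructor <;> nlinarith [h1.1, h1.2, hst.1, hst.2]
  · have h1 := C.planar_of_mem_Cell h i
    rw [Pi.add_apply] at h1
    constructor <;> nlinarith [h1.1, h1.2]

/-- **`ExitGeom`** for KN's cells. [cite: KozmaNitzan2024, §4 pp. 26–27] -/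
theorem exitGeom_ofCells : ExitGeom (zdGraph d) (CellGeom.ofCells C) where
  M_subset_Q _ v := by
    intro y hy
    change y ∈ C.M v at hy
    change y ∈ C.Q v
    rw [Cells.M, mem_cIcc_iff] at hy
    rw [Cells.Q, mem_cIcc_iff]
    intro i; have := hy i; push_cast at this ⊢; constructor <;> linarith [this.1, this.2]
  Cell_disjoint_Q _ _ u x hux := Finset.disjoint_left.2 fun y hy hy' => ((C.cell_sep_Q hux) y hy y hy').1 rfl
  Zone_disjoint_Q _ _ u δ x := by
    rw [Finset.disjoint_left]
    intro y hy hy'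
    by_cases hux : u = x
    · subst hux
      change y ∈ C.Zone u δ at hy
      change y ∈ C.Q u at hy'
      rw [Cells.Zone, mem_sBox_iff (sgOf_sign δ)] at hy
      have h1 := (C.level_of_mem_Q (δ := δ) hy').1.2
      have hr : (1 : ℤ) ≤ C.r := by exact_mod_cast C.r_pos
      linarith [hy.1.1]
    · exact ((C.zone_sep_Q (δ := δ) hux) y hy y hy').1 rfl
  locFin y := by
    set B : Site 2 := fun i => |y (C.pax i)| + 30 * C.r + 1 with hB
    refine (Finset.Icc (-B) B).finite_toSet.subset ?_
    rintro v ⟨_, w, δ, rfl, b, hb, hadj⟩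
    change b ∈ C.Ewv w δ at hb
    rw [Finset.coe_Icc, Set.mem_Icc]
    have hr : (1 : ℤ) ≤ C.r := by exact_mod_cast C.r_pos
    have key : ∀ i, |(w + stepVec δ) i| ≤ B i := by
      intro i
      have h1 := abs_le.1 (planar_of_mem_Ewv C hb i)
      have h2 := abs_le.1 (abs_sub_le_one_of_adj hadj (C.pax i))
      simp only [hB]
      have hy := le_abs_self (y (C.pax i))
      have hy' := neg_abs_le (y (C.pax i))
      rw [abs_le]
      constructor <;> nlinarith [h1.1, h1.2, h2.1, h2.2]
    exact ⟨fun i => (abs_le.1 (key i)).1, fun i => (abs_le.1 (key i)).2⟩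

/-! ## §4 Faces, corridors, `StepsGeom` -/

/-- **KN's faces and corridors as face data** (trivial anchors). [cite: KozmaNitzan2024, §4 p. 26 (H_{v,x}), p. 30 (F^j_{v,x})] -/
def faceDataOfCells : FaceData (Site d) Unit where
  Face := fun _ v δ j => C.Face v δ j
  Hfull := fun _ v δ => C.Hfull v δ

/-- **`StepsGeom`** for KN's cells. [cite: KozmaNitzan2024, §4 pp. 26, 30] -/
theorem stepsGeom_ofCells : StepsGeom (CellGeom.ofCells C) (faceDataOfCells C) where
  Face_subset_Stub _ v δ j := by
    have h0 : (0 : ℤ) ≤ 10 * C.s * j := by positivity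
    exact sBox_mono (sgOf_sign δ) _ (by linarith) le_rfl le_rfl
  Stub_subset_Hfull _ v δ _ hj := C.Stub_subset_Hfull v δ hj
  Hfull_subset _ _ v δ _ := fun y hy => Finset.mem_union.2 (C.mem_Q_or_Efar_of_mem_Hfull hy)
  M_tgt_subset_Efar _ v δ := C.M_tgt_subset_Efar v δ

/-! ## §5 The level data and `LevelGeom` -/

/-- **KN's level function** `σ (y_a - cen_v,a)` along `δ = (a, σ)`, the face levels `L j = 5r + 10sj` and the bound `ℓQ = 5r` for the
levels of `Q_v` and of `H_{v,x} \ E_{v,x}`. [cite: KozmaNitzan2024, §4 pp. 26, 30–31] -/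
def levelDataOfCells : LevelData (Site d) Unit where
  lev := fun _ v δ y => sgOf δ * (y (C.axOf δ) - C.cen v (C.axOf δ))
  L := fun j => 5 * C.r + 10 * C.s * j
  ℓQ := 5 * C.r

/-- **`LevelGeom`** for KN's cells with KN's level function. [cite: KozmaNitzan2024, §4 pp. 26, 30–31 (Step IV)] -/
theorem levelGeom_ofCells : LevelGeom (zdGraph d) (CellGeom.ofCells C) (faceDataOfCells C) (levelDataOfCells C) where
  adj_le _ v δ y z hadj := by
    change sgOf δ * (z (C.axOf δ) - C.cen v (C.axOf δ)) ≤ sgOf δ * (y (C.axOf δ) - C.cen v (C.axOf δ)) + 1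
    have h := abs_le.1 (abs_sub_le_one_of_adj hadj (C.axOf δ))
    rcases sgOf_sign δ with hs | hs <;> rw [hs] <;> linarith [h.1, h.2]
  lev_Q _ _ v δ _ y hy := by
    change sgOf δ * (y (C.axOf δ) - C.cen v (C.axOf δ)) ≤ 5 * (C.r : ℤ)
    exact (C.level_of_mem_Q (δ := δ) hy).1.2
  lev_Hfull _ v δ y hy hyE := by
    change sgOf δ * (y (C.axOf δ) - C.cen v (C.axOf δ)) ≤ 5 * (C.r : ℤ)
    change y ∈ C.Hfull v δ at hy
    change y ∉ C.Efar v δ at hyE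
    rw [Cells.Hfull, mem_sBox_iff (sgOf_sign δ)] at hy
    obtain ⟨⟨h1, h2⟩, htr⟩ := hy
    by_contra hlt
    apply hyE
    rw [Cells.Efar, mem_sBox_iff (sgOf_sign δ)]
    refine ⟨⟨by linarith, by linarith⟩, fun j hj => ?_⟩
    have := htr j hj
    have hr : (0 : ℤ) ≤ C.r := by positivity
    constructor <;> linarith [this.1, this.2]
  ℓQ_lt j hj := by
    change (5 * C.r : ℤ) < 5 * C.r + 10 * C.s * j
    have hs : (1 : ℤ) ≤ C.s := by exact_mod_cast C.hs
    have hj' : (1 : ℤ) ≤ j := by exact_mod_cast hj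
    nlinarith
  mem_Stub _ v δ j _ _ y hy hle := by
    change sgOf δ * (y (C.axOf δ) - C.cen v (C.axOf δ)) ≤ 5 * C.r + 10 * C.s * j at hle
    change y ∈ C.Hfull v δ at hy
    change y ∈ C.Stub v δ j
    rw [Cells.Hfull, mem_sBox_iff (sgOf_sign δ)] at hy
    rw [Cells.Stub, mem_sBox_iff (sgOf_sign δ)]
    exact ⟨⟨hy.1.1, hle⟩, hy.2⟩
  mem_Face _ v δ j _ _ y hy heq := by
    change sgOf δ * (y (C.axOf δ) - C.cen v (C.axOf δ)) = 5 * C.r + 10 * C.s * j at heq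
    change y ∈ C.Hfull v δ at hy
    change y ∈ C.Face v δ j
    rw [Cells.Hfull, mem_sBox_iff (sgOf_sign δ)] at hy
    rw [Cells.Face, mem_sBox_iff (sgOf_sign δ)]
    exact ⟨⟨heq.ge, heq.le⟩, hy.2⟩
  Face_far _ v δ j hjK t ht := by
    change j + 1 ≤ C.K at hjK
    change t ∈ C.Face v δ (j + 1) at ht
    change t ∈ C.Efar v δ ∧ 5 * (C.r : ℤ) + 10 * C.s * (j : ℕ) + 1 ≤ sgOf δ * (t (C.axOf δ) - C.cen v (C.axOf δ))
    rw [Cells.Face, mem_sBox_iff (sgOf_sign δ)] at ht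
    obtain ⟨⟨h1, h2⟩, htr⟩ := ht
    push_cast at h1 h2
    have hs : (1 : ℤ) ≤ C.s := by exact_mod_cast C.hs
    have hr : (C.r : ℤ) = C.K * C.s := by unfold Cells.r; push_cast; ring
    have hjK' : (j : ℤ) + 1 ≤ C.K := by exact_mod_cast hjK
    have hj0 : (0 : ℤ) ≤ j := by positivity
    have hjs : 10 * (C.s : ℤ) * (j + 1) ≤ 10 * C.s * C.K := mul_le_mul_of_nonneg_left hjK' (by positivity)
    refine ⟨?_, by nlinarith⟩
    rw [Cells.Efar, mem_sBox_iff (sgOf_sign δ)]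
    refine ⟨⟨by nlinarith, by nlinarith⟩, fun i hi => ?_⟩
    have := htr i hi
    have hr0 : (0 : ℤ) ≤ C.r := by positivity
    constructor <;> linarith [this.1, this.2]
  M_far _ v δ t ht := by
    change t ∈ C.M (v + stepVec δ) at ht
    change t ∈ C.Efar v δ ∧ 5 * (C.r : ℤ) + 10 * C.s * (C.K : ℕ) + 1 ≤ sgOf δ * (t (C.axOf δ) - C.cen v (C.axOf δ))
    refine ⟨C.M_tgt_subset_Efar v δ ht, ?_⟩
    have h := (C.level_of_mem_M_tgt ht).1.1
    have hr : (C.r : ℤ) = C.K * C.s := by unfold Cells.r; push_cast; ring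
    have hr1 : (1 : ℤ) ≤ C.r := by exact_mod_cast C.r_pos
    nlinarith
  Btw_sep_Efar _ _ w δw du hdu := by
    change Sep (zdGraph d) (C.Btw w δw) (C.Efar (w + stepVec δw) du)
    rw [← C.Btw_rev w δw]
    exact fun y hy z hz => C.Btw_sep_Efar (Ne.symm hdu) y hy z hz
  Cell_sep_Efar _ _ u v δ huv hux := fun y hy z hz => C.cell_sep_Efar huv hux y hy z hz
  Zone_sep_Efar _ _ u δ' v δ huv hux := fun y hy z hz => C.zone_sep_Efar huv hux y hy z hz

/-! ## §6 The envelope bound -/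

/-- The envelope region of the instance is KN's `envRegion`. [cite: KozmaNitzan2024, §4 p. 27 (E_{i+1})] -/
theorem ofKSch_envRegion₂ (S : KSch d) (h : ProbeHistory (Site d)) (e : Site 2 × MDir) (a a' : Unit) :
    (KSchA.ofKSch S).envRegion₂ (zdGraph d) h e a a' = S.envRegion h e := by
  unfold KSchA.envRegion₂ KSch.envRegion
  rw [KSchA.ofKSch_onward]
  rfl

/-- **`hB`** on `ℤ^d`: `#envRegion₂ h e a a' ≤ (70r+1)^d`, uniformly. [cite: KozmaNitzan2024, §4 p. 27 (E_{i+1})] -/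
theorem card_envRegion₂_ofKSch_le (S : KSch d) (h : ProbeHistory (Site d)) (e : Site 2 × MDir) (a a' : Unit) :
    ((KSchA.ofKSch S).envRegion₂ (zdGraph d) h e a a').card ≤ (70 * S.C.r + 1) ^ d := by
  rw [ofKSch_envRegion₂]
  refine (Finset.card_le_card (SameP.envRegion_subset_cube S h e)).trans (card_Icc_le_pow fun k => ?_)
  simp only [Pi.add_apply, Pi.sub_apply, Pi.natCast_apply]
  omega

end ZdReg

end KNCells

end Transplant

end Summit.CriticalPhenomena.PercolationContinuityZ3.Theorems

end
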